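import Summits.QuantumFields.YangMills.Theorems.SwapVirialDeficitBlowUpChartDeficitGrowthTwisted
import Summits.QuantumFields.YangMills.Theorems.SwapVirialDeficitSwapRingCommBoxTwisted
import Summits.QuantumFields.YangMills.Theorems.SwapVirialDeficitQuantitativeLaplaceCoerciveOfGrowth
import HarnessLib

/-!
# W8, second input: the SECTOR-`z` chart deficit is two-sided equivalent to the SIGNED box — `F̂_z(C,U) ≤ 300·L⁴·(t + s)²`, the sector-`z` THIN-TORON ENERGY
# `F̂_z(C,1) ≤ 300·L⁴·s²`, and the sector-`z` FOLLOWER COERCIVITY modulo the quartic Taylor datum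
# (free-hands support of ⟨stmt-QuantumFields-24197⟩ `SwapVirialDeficit.SwapGluedStiffness`; the `001` twins of ✓`…BlowUpChartDeficitBox` ∕ ✓`…BlowUpFollowerCoercivity`
# for LEAD ym-line-sfw-p2 g97's sector-wise Morse–Bott plan, brick W8)

With the sector character `χ_z(x) = centreElem((z 0 ∧ x₀ ≠ 0) ⊻ (z 1 ∧ x₁ ≠ 0) ⊻ (z 2 ∧ x₂ ≠ 0))` and `F̂_z = chartDeficit L z χ_z`, the ring-level SIGNED-box bound
✓`SwapRing.swapRingDeficit_le_of_commBox_twisted` read in w2 g57's ring chart `q = (C,U) ↦ fixHistory (ringConfig χ_z q)` (followers = relative box coordinates,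
exactly as in ✓`chartBox_of_chartDeficit_twisted`) gives:

* ★★ `chartDeficit_twisted_le_of_box (z)` — `‖[C_μ,C_ν]‖_F ≤ s`, SIGNED relations `‖c·C_{σμ} − centreElem(z μ)·C_μ·c‖_F ≤ s`, `‖U_i − 1‖_F ≤ t` ⟹ `F̂_z(C,U) ≤ 300·L⁴·(t+s)²`;
* ★★ `chartDeficit_twisted_one_le_of_relations (z)` — the sector-`z` THIN-TORON ENERGY `F̂_z(C, 1) ≤ 300·L⁴·s²` (for `z = 001`: the thin toron of the minus valley
  `cC₁ ≈ C₀c, cC₀ ≈ C₁c, cC₂ ≈ −C₂c`), two-sided with ✓`signedRelations_sq_sum_le_chartDeficit_twisted`;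
* ★ `chartDeficit_twisted_ge_sum_follower_frobNorm_sq` (growth `(2304L⁶|Fol L|)⁻¹·Σ‖U_i − 1‖²_F ≤ F̂_z`);
* ★★★ `follower_coercivity_of_taylor_twisted (z)` — for any Frobenius-comparable follower chart `Ψ` (`κ‖y‖² ≤ Σ‖Ψ(y)_i − 1‖²_F` on `‖y‖ ≤ R`), every leader tuple with
  SIGNED relations `≤ s` and every candidate Hessian `A` with the quartic Taylor datum of `y ↦ F̂_z(C, Ψ y)` at `0`:
  `(2κ/(2304·L⁶·|Fol L|) − 2·(300L⁴s²)/R² − 2B₄R²)·‖y‖² ≤ ⟪A y, y⟫` — hub-angle independent, polynomial in `L`, EVERY sector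
  (✓`QuantitativeLaplace.inner_ge_of_growth_of_taylor_offset`); ★★ `follower_coercivity_of_taylor_half_twisted` the tuned form `μ‖y‖² ≤ ⟪Ay,y⟫`.
What is NOT here: the sector-`z` Taylor datum (order-4 jets), the tip, the assembly.

HONEST LABEL: bookkeeping ∕ composition of landed inequalities; ⟨24197⟩ (window-uniform) ∕ ⟨24196⟩ ∕ ⟨24194⟩ ∕ ⟨24497⟩ OPEN; own crux ⟨22884⟩ OPEN (blocked-on ⟨19935⟩);
no crux, rung of record or summit is proved; the Yang–Mills mass gap is NOT proved; no summit is proved by a line.  THEOREMS ONLY (0 `def`, 0 `sorry`), standard axioms.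
Width seat ym-line-sfw-p2-w3 g65 (cell ym-idea-1, free hands), `--supports stmt-QuantumFields-24197`.  References: [cite: tHooft1979]; [cite: Luscher1983, §2]; [folklore].
-/

set_option autoImplicit false

noncomputable section

open MeasureTheory
open scoped BigOperators InnerProductSpace
open Literature.MathematicalPhysics.QuantumFieldTheory hiding SU2
open Literature.MathematicalPhysics.QuantumLattice

namespace Summit.QuantumFields.YangMills.Theorems.SwapVirialDeficit.BlowUpRing

open Summit.QuantumFields.YangMills.Theorems.FemtoTransferGap
open Summit.QuantumFields.YangMills.Theorems.FemtoTransferGap.TT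
open Summit.QuantumFields.YangMills.Theorems.VirialFluxGap.RingDeficit
open Summit.QuantumFields.YangMills.Theorems.VirialFluxGap.FixSplit (FixSpace)
open Summit.QuantumFields.YangMills.Theorems.SwapTwistDeficit.PeriodicRingFloor
open Summit.QuantumFields.YangMills.Theorems.SwapVirialDeficit.SwapRing
open Summit.QuantumFields.YangMills.Theorems.SwapVirialDeficit.SwapRingTwisted (parity_zero)
open Summit.QuantumFields.YangMills.Theorems.QuantitativeLaplace (inner_ge_of_growth_of_taylor_offset)

variable {L : ℕ} [NeZero L]

/-! ## §1 The signed box bounds the sector-`z` chart deficit -/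

/-- ★★ **THE SIGNED BOX BOUNDS THE SECTOR-`z` CHART DEFICIT**: for `q = (C, U)`, `0 ≤ t, s`, if `‖C_μC_ν − C_νC_μ‖_F ≤ s`, `‖c·C_{σμ} − centreElem(z μ)·C_μ·c‖_F ≤ s`
(`c = C 3`) and `‖U_i − 1‖_F ≤ t` for all followers, then `F̂_z(C,U) = chartDeficit L z χ_z q ≤ 300·L⁴·(t + s)²`
(✓`SwapRing.swapRingDeficit_le_of_commBox_twisted` in the ring chart with the sector character `χ_z`). [cite: tHooft1979] [cite: Luscher1983, §2] -/
theorem chartDeficit_twisted_le_of_box (z : Fin 3 → Bool) (q : (Fin 4 → SU2) × (Fol L → SU2)) {t s : ℝ} (ht : 0 ≤ t) (hs : 0 ≤ s)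
    (hCC : ∀ μ ν : Fin 3, frobNorm (((q.1 (Fin.castSucc μ) * q.1 (Fin.castSucc ν) : SU2) : Matrix (Fin 2) (Fin 2) ℂ) -
        ((q.1 (Fin.castSucc ν) * q.1 (Fin.castSucc μ) : SU2) : Matrix (Fin 2) (Fin 2) ℂ)) ≤ s)
    (hσ : ∀ μ : Fin 3, frobNorm (((q.1 (Fin.last 3) * q.1 (Fin.castSucc (Equiv.swap (0 : Fin 3) 1 μ)) : SU2) : Matrix (Fin 2) (Fin 2) ℂ) -
        ((centreElem (z μ) * q.1 (Fin.castSucc μ) * q.1 (Fin.last 3) : SU2) : Matrix (Fin 2) (Fin 2) ℂ)) ≤ s)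
    (hU : ∀ i : Fol L, frobNorm (((q.2 i : SU2) : Matrix (Fin 2) (Fin 2) ℂ) - 1) ≤ t) :
    chartDeficit L z (fun x => centreElem (Bool.xor (z 0 && decide (x 0 ≠ 0)) (Bool.xor (z 1 && decide (x 1 ≠ 0)) (z 2 && decide (x 2 ≠ 0))))) q ≤
      300 * (L : ℝ) ^ 4 * (t + s) ^ 2 := by
  set χ : Site 3 L → SU2 := fun x => centreElem (Bool.xor (z 0 && decide (x 0 ≠ 0)) (Bool.xor (z 1 && decide (x 1 ≠ 0)) (z 2 && decide (x 2 ≠ 0))))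
    with hχ
  have hF : swapRingDeficit L z ((Fin.cons (glue (ringConfig χ q).1) (ringConfig χ q).2.1 : Fin (2 * L - 1 + 1) → GaugeConfig 3 L SU2), (ringConfig χ q).2.2) =
      chartDeficit L z χ q := rfl
  rw [← hF]
  refine swapRingDeficit_le_of_commBox_twisted z ht hs (ringConfig χ q).1 (ringConfig χ q).2.1 (ringConfig χ q).2.2
    (fun μ ν => ?_) (fun μ => ?_) (fun i => ?_) (fun j e => ?_) (fun x => ?_)
  · simpa only [ringConfig_fst_lead] using hCC μ ν
  · simpa only [ringConfig_fst_lead, ringConfig_snd_snd_zero] using hσ μ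
  · by_cases hi : isLead i = true
    · -- a leader is its own letter: the relative coordinate is `1`
      have hcond : i.1.1 i.1.2 = -1 := apply_eq_neg_one_of_isLead hi
      have heq : (⟨(Pi.single i.1.2 (-1 : ZMod L), i.1.2), leader_not_treeEdge i.1.2⟩ : OffIdx L) = i := (eq_lead_of_isLead hi).symm
      rw [if_pos hcond, heq, inv_mul_cancel, OneMemClass.coe_one, sub_self, frobNorm_zero]
      exact ht
    · have h := hU (Sum.inl ⟨i, hi⟩)
      have hw : (ringConfig χ q).1 i = letter (fun μ => q.1 (Fin.castSucc μ)) i * q.2 (Sum.inl ⟨i, hi⟩) :=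
        ringConfig_fst_of_not_isLead χ q ⟨i, hi⟩
      have hl : (if i.1.1 i.1.2 = -1 then (ringConfig χ q).1 ⟨(Pi.single i.1.2 (-1 : ZMod L), i.1.2), leader_not_treeEdge i.1.2⟩ else 1) =
          letter (fun μ => q.1 (Fin.castSucc μ)) i := by
        simp only [ringConfig_fst_lead]; rfl
      rw [hl, hw, inv_mul_cancel_left]
      exact h
  · have h := hU (Sum.inr (Sum.inl (j, e)))
    rwa [ringConfig_snd_fst, inv_mul_cancel_left]
  · by_cases hx : x = 0
    · subst hx
      rw [parity_zero z, show centreElem false = (1 : SU2) from rfl, one_mul, inv_mul_cancel, OneMemClass.coe_one, sub_self, frobNorm_zero]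
      exact ht
    · have h := hU (Sum.inr (Sum.inr ⟨x, hx⟩))
      have hg : (ringConfig χ q).2.2 x = χ x * q.1 (Fin.last 3) * q.2 (Sum.inr (Sum.inr ⟨x, hx⟩)) := ringConfig_snd_snd_of_ne χ q ⟨x, hx⟩
      have e2 : χ x = centreElem (Bool.xor (z 0 && decide (x 0 ≠ 0)) (Bool.xor (z 1 && decide (x 1 ≠ 0)) (z 2 && decide (x 2 ≠ 0)))) := rfl
      rw [hg, ringConfig_snd_snd_zero, ← e2, inv_mul_cancel_left]
      exact h

/-- ★★ **THE SECTOR-`z` THIN-TORON ENERGY**: for every leader tuple `C` with commutators `≤ s` and SIGNED σ-relations `‖c·C_{σμ} − centreElem(z μ)·C_μ·c‖_F ≤ s`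
(`0 ≤ s`), `F̂_z(C, 1) = chartDeficit L z χ_z (C, 1) ≤ 300·L⁴·s²` — the deficit of the rebuilt sector-`z` ring with all followers at their references is polynomially
small in the signed-relation size, uniformly in the hub angle (the `f₀` of ✓`inner_ge_of_growth_of_taylor_offset` on the sector's near-flat base).
[cite: tHooft1979] [cite: Luscher1983, §2] -/
theorem chartDeficit_twisted_one_le_of_relations (z : Fin 3 → Bool) (C : Fin 4 → SU2) {s : ℝ} (hs : 0 ≤ s)
    (hCC : ∀ μ ν : Fin 3, frobNorm (((C (Fin.castSucc μ) * C (Fin.castSucc ν) : SU2) : Matrix (Fin 2) (Fin 2) ℂ) -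
        ((C (Fin.castSucc ν) * C (Fin.castSucc μ) : SU2) : Matrix (Fin 2) (Fin 2) ℂ)) ≤ s)
    (hσ : ∀ μ : Fin 3, frobNorm (((C (Fin.last 3) * C (Fin.castSucc (Equiv.swap (0 : Fin 3) 1 μ)) : SU2) : Matrix (Fin 2) (Fin 2) ℂ) -
        ((centreElem (z μ) * C (Fin.castSucc μ) * C (Fin.last 3) : SU2) : Matrix (Fin 2) (Fin 2) ℂ)) ≤ s) :
    chartDeficit L z (fun x => centreElem (Bool.xor (z 0 && decide (x 0 ≠ 0)) (Bool.xor (z 1 && decide (x 1 ≠ 0)) (z 2 && decide (x 2 ≠ 0)))))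
      (C, fun _ => 1) ≤ 300 * (L : ℝ) ^ 4 * s ^ 2 := by
  have h := chartDeficit_twisted_le_of_box (L := L) z (C, fun _ => 1) le_rfl hs hCC hσ
    (fun i => by rw [OneMemClass.coe_one, sub_self, frobNorm_zero])
  simpa only [zero_add] using h

/-- ★ **Growth, sector `z`, normalised**: `(2304·L⁶·|Fol L|)⁻¹·Σ_i‖U_i − 1‖²_F ≤ F̂_z(C,U)` (✓`sum_follower_frobNorm_sq_le_chartDeficit_twisted`). [cite: Luscher1983, §2] -/
theorem chartDeficit_twisted_ge_sum_follower_frobNorm_sq (z : Fin 3 → Bool) (q : (Fin 4 → SU2) × (Fol L → SU2)) :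
    (2304 * (L : ℝ) ^ 6 * (Fintype.card (Fol L) : ℝ))⁻¹ * ∑ i : Fol L, frobNorm (((q.2 i : SU2) : Matrix (Fin 2) (Fin 2) ℂ) - 1) ^ 2 ≤
      chartDeficit L z (fun x => centreElem (Bool.xor (z 0 && decide (x 0 ≠ 0)) (Bool.xor (z 1 && decide (x 1 ≠ 0)) (z 2 && decide (x 2 ≠ 0))))) q := by
  have hL : (0 : ℝ) < L := by exact_mod_cast NeZero.pos L
  have hcard : 0 < Fintype.card (Fol L) := by rw [card_fol]; have := Nat.one_le_pow 4 L NeZero.one_le; omega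
  have hK : (0 : ℝ) < 2304 * (L : ℝ) ^ 6 * (Fintype.card (Fol L) : ℝ) := by positivity
  rw [inv_mul_le_iff₀ hK]
  exact sum_follower_frobNorm_sq_le_chartDeficit_twisted z q

/-! ## §2 Follower coercivity in sector `z`, modulo the quartic Taylor datum -/

variable {V : Type*} [NormedAddCommGroup V] [InnerProductSpace ℝ V]

/-- ★★★ **SECTOR-`z` FOLLOWER COERCIVITY AT `U ≡ 1`, UNIFORM OVER THE SECTOR'S NEAR-FLAT LEADERS, MODULO THE QUARTIC TAYLOR DATUM.**  Let
`Ψ : V → (Fol L → SU2)` be Frobenius-comparable on `‖y‖ ≤ R` (`κ‖y‖² ≤ Σ_i‖Ψ(y)_i − 1‖²_F`), `C` a leader tuple with commutators and SIGNED σ-relations `≤ s`, and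
`A : V →ₗ[ℝ] V` a candidate Hessian with `∃ σ odd, |F̂_z(C, Ψ y) − F̂_z(C, 1) − ½⟪A y, y⟫ − σ y| ≤ B₄‖y‖⁴` on the ball.  Then for every `y`
`(2κ/(2304·L⁶·|Fol L|) − 2·(300·L⁴·s²)/R² − 2B₄R²)·‖y‖² ≤ ⟪A y, y⟫`. [cite: Luscher1983, §2] -/
theorem follower_coercivity_of_taylor_twisted (z : Fin 3 → Bool) (Ψ : V → (Fol L → SU2)) {κ R s B₄ : ℝ} (hR : 0 < R) (hs : 0 ≤ s)
    (hΨ : ∀ y : V, ‖y‖ ≤ R → κ * ‖y‖ ^ 2 ≤ ∑ i : Fol L, frobNorm (((Ψ y i : SU2) : Matrix (Fin 2) (Fin 2) ℂ) - 1) ^ 2)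
    (C : Fin 4 → SU2)
    (hCC : ∀ μ ν : Fin 3, frobNorm (((C (Fin.castSucc μ) * C (Fin.castSucc ν) : SU2) : Matrix (Fin 2) (Fin 2) ℂ) -
        ((C (Fin.castSucc ν) * C (Fin.castSucc μ) : SU2) : Matrix (Fin 2) (Fin 2) ℂ)) ≤ s)
    (hσ : ∀ μ : Fin 3, frobNorm (((C (Fin.last 3) * C (Fin.castSucc (Equiv.swap (0 : Fin 3) 1 μ)) : SU2) : Matrix (Fin 2) (Fin 2) ℂ) -
        ((centreElem (z μ) * C (Fin.castSucc μ) * C (Fin.last 3) : SU2) : Matrix (Fin 2) (Fin 2) ℂ)) ≤ s)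
    {A : V →ₗ[ℝ] V}
    (hT : ∃ σ : V → ℝ, (∀ y, σ (-y) = -σ y) ∧ ∀ y : V, ‖y‖ ≤ R →
      |chartDeficit L z (fun x => centreElem (Bool.xor (z 0 && decide (x 0 ≠ 0)) (Bool.xor (z 1 && decide (x 1 ≠ 0)) (z 2 && decide (x 2 ≠ 0)))))
            (C, Ψ y) -
          chartDeficit L z (fun x => centreElem (Bool.xor (z 0 && decide (x 0 ≠ 0)) (Bool.xor (z 1 && decide (x 1 ≠ 0)) (z 2 && decide (x 2 ≠ 0)))))
            (C, fun _ => 1) -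
          (1 / 2) * ⟪A y, y⟫_ℝ - σ y| ≤ B₄ * ‖y‖ ^ 4)
    (y : V) :
    (2 * (κ / (2304 * (L : ℝ) ^ 6 * (Fintype.card (Fol L) : ℝ))) - 2 * (300 * (L : ℝ) ^ 4 * s ^ 2) / R ^ 2 - 2 * B₄ * R ^ 2) * ‖y‖ ^ 2 ≤
      ⟪A y, y⟫_ℝ := by
  set χ : Site 3 L → SU2 := fun x => centreElem (Bool.xor (z 0 && decide (x 0 ≠ 0)) (Bool.xor (z 1 && decide (x 1 ≠ 0)) (z 2 && decide (x 2 ≠ 0))))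
    with hχ
  have hL : (0 : ℝ) < L := by exact_mod_cast NeZero.pos L
  have hcard : 0 < Fintype.card (Fol L) := by rw [card_fol]; have := Nat.one_le_pow 4 L NeZero.one_le; omega
  have hK : (0 : ℝ) < 2304 * (L : ℝ) ^ 6 * (Fintype.card (Fol L) : ℝ) := by positivity
  -- growth: `(κ/K)·‖y‖² ≤ F̂_z(C, Ψ y)` on the ball
  have hgrowth : ∀ y : V, ‖y‖ ≤ R → κ / (2304 * (L : ℝ) ^ 6 * (Fintype.card (Fol L) : ℝ)) * ‖y‖ ^ 2 ≤ chartDeficit L z χ (C, Ψ y) := by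
    intro y hy
    have h1 := chartDeficit_twisted_ge_sum_follower_frobNorm_sq (L := L) z (C, Ψ y)
    have h2 := hΨ y hy
    calc κ / (2304 * (L : ℝ) ^ 6 * (Fintype.card (Fol L) : ℝ)) * ‖y‖ ^ 2
        = (2304 * (L : ℝ) ^ 6 * (Fintype.card (Fol L) : ℝ))⁻¹ * (κ * ‖y‖ ^ 2) := by rw [div_eq_inv_mul]; ring
      _ ≤ (2304 * (L : ℝ) ^ 6 * (Fintype.card (Fol L) : ℝ))⁻¹ * ∑ i : Fol L, frobNorm (((Ψ y i : SU2) : Matrix (Fin 2) (Fin 2) ℂ) - 1) ^ 2 :=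
          mul_le_mul_of_nonneg_left h2 (inv_nonneg.2 hK.le)
      _ ≤ _ := h1
  -- the sector's thin-toron constant `f₀ = F̂_z(C,1) ≤ 300 L⁴ s²`
  have hf₀ := chartDeficit_twisted_one_le_of_relations (L := L) z C hs hCC hσ
  have hmain := inner_ge_of_growth_of_taylor_offset (A := A) (f := fun y => chartDeficit L z χ (C, Ψ y)) (f₀ := chartDeficit L z χ (C, fun _ => 1))
    hR hgrowth hT y
  -- monotonicity of the constant in `f₀`
  have hR2 : 0 < R ^ 2 := by positivity
  have hmono : 2 * (κ / (2304 * (L : ℝ) ^ 6 * (Fintype.card (Fol L) : ℝ))) - 2 * (300 * (L : ℝ) ^ 4 * s ^ 2) / R ^ 2 - 2 * B₄ * R ^ 2 ≤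
      2 * (κ / (2304 * (L : ℝ) ^ 6 * (Fintype.card (Fol L) : ℝ))) - 2 * chartDeficit L z χ (C, fun _ => 1) / R ^ 2 - 2 * B₄ * R ^ 2 := by
    have : 2 * chartDeficit L z χ (C, fun _ => 1) / R ^ 2 ≤ 2 * (300 * (L : ℝ) ^ 4 * s ^ 2) / R ^ 2 := by
      gcongr
    linarith
  calc _ ≤ (2 * (κ / (2304 * (L : ℝ) ^ 6 * (Fintype.card (Fol L) : ℝ))) - 2 * chartDeficit L z χ (C, fun _ => 1) / R ^ 2 - 2 * B₄ * R ^ 2) * ‖y‖ ^ 2 :=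
        mul_le_mul_of_nonneg_right hmono (by positivity)
    _ ≤ _ := hmain

/-- ★★ **The tuned sufficient condition, sector `z`**: with `μ := κ/(2304·L⁶·|Fol L|)`, if `2·(300L⁴s²) ≤ μ·R²/2` and `2B₄R² ≤ μ/2` then `μ·‖y‖² ≤ ⟪A y, y⟫` —
the sector-`z` follower block is uniformly `μ`-coercive at `U ≡ 1` over the sector's whole near-flat base `{signed relations ≤ s}`, thresholds polynomial in `L`,
free of the hub angle. [cite: Luscher1983, §2] -/
theorem follower_coercivity_of_taylor_half_twisted (z : Fin 3 → Bool) (Ψ : V → (Fol L → SU2)) {κ R s B₄ : ℝ} (hR : 0 < R) (hs : 0 ≤ s)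
    (hΨ : ∀ y : V, ‖y‖ ≤ R → κ * ‖y‖ ^ 2 ≤ ∑ i : Fol L, frobNorm (((Ψ y i : SU2) : Matrix (Fin 2) (Fin 2) ℂ) - 1) ^ 2)
    (hsmall₁ : 2 * (300 * (L : ℝ) ^ 4 * s ^ 2) ≤ κ / (2304 * (L : ℝ) ^ 6 * (Fintype.card (Fol L) : ℝ)) * R ^ 2 / 2)
    (hsmall₂ : 2 * B₄ * R ^ 2 ≤ κ / (2304 * (L : ℝ) ^ 6 * (Fintype.card (Fol L) : ℝ)) / 2)
    (C : Fin 4 → SU2)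
    (hCC : ∀ μ ν : Fin 3, frobNorm (((C (Fin.castSucc μ) * C (Fin.castSucc ν) : SU2) : Matrix (Fin 2) (Fin 2) ℂ) -
        ((C (Fin.castSucc ν) * C (Fin.castSucc μ) : SU2) : Matrix (Fin 2) (Fin 2) ℂ)) ≤ s)
    (hσ : ∀ μ : Fin 3, frobNorm (((C (Fin.last 3) * C (Fin.castSucc (Equiv.swap (0 : Fin 3) 1 μ)) : SU2) : Matrix (Fin 2) (Fin 2) ℂ) -
        ((centreElem (z μ) * C (Fin.castSucc μ) * C (Fin.last 3) : SU2) : Matrix (Fin 2) (Fin 2) ℂ)) ≤ s)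
    {A : V →ₗ[ℝ] V}
    (hT : ∃ σ : V → ℝ, (∀ y, σ (-y) = -σ y) ∧ ∀ y : V, ‖y‖ ≤ R →
      |chartDeficit L z (fun x => centreElem (Bool.xor (z 0 && decide (x 0 ≠ 0)) (Bool.xor (z 1 && decide (x 1 ≠ 0)) (z 2 && decide (x 2 ≠ 0)))))
            (C, Ψ y) -
          chartDeficit L z (fun x => centreElem (Bool.xor (z 0 && decide (x 0 ≠ 0)) (Bool.xor (z 1 && decide (x 1 ≠ 0)) (z 2 && decide (x 2 ≠ 0)))))
            (C, fun _ => 1) -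
          (1 / 2) * ⟪A y, y⟫_ℝ - σ y| ≤ B₄ * ‖y‖ ^ 4)
    (y : V) :
    κ / (2304 * (L : ℝ) ^ 6 * (Fintype.card (Fol L) : ℝ)) * ‖y‖ ^ 2 ≤ ⟪A y, y⟫_ℝ := by
  have h := follower_coercivity_of_taylor_twisted (L := L) z Ψ hR hs hΨ C hCC hσ hT y
  have hR2 : 0 < R ^ 2 := by positivity
  set μ : ℝ := κ / (2304 * (L : ℝ) ^ 6 * (Fintype.card (Fol L) : ℝ)) with hμ
  have h1 : 2 * (300 * (L : ℝ) ^ 4 * s ^ 2) / R ^ 2 ≤ μ / 2 := by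
    rw [div_le_iff₀ hR2]
    calc 2 * (300 * (L : ℝ) ^ 4 * s ^ 2) ≤ μ * R ^ 2 / 2 := hsmall₁
      _ = μ / 2 * R ^ 2 := by ring
  have hcoef : μ ≤ 2 * μ - 2 * (300 * (L : ℝ) ^ 4 * s ^ 2) / R ^ 2 - 2 * B₄ * R ^ 2 := by linarith
  calc μ * ‖y‖ ^ 2 ≤ (2 * μ - 2 * (300 * (L : ℝ) ^ 4 * s ^ 2) / R ^ 2 - 2 * B₄ * R ^ 2) * ‖y‖ ^ 2 :=
        mul_le_mul_of_nonneg_right hcoef (by positivity)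
    _ ≤ _ := h

end Summit.QuantumFields.YangMills.Theorems.SwapVirialDeficit.BlowUpRing

end
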